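import Summits.QuantumFields.YangMills.Theorems.PoincareLipschitzImproveCoreOfFlat
import Summits.QuantumFields.YangMills.Theorems.PoincareLipschitzImproveOfCore
import Summits.QuantumFields.YangMills.Theorems.PoincareLipschitzHistoryTailOfImprove
import Literature.MathematicalPhysics.QuantumFieldTheory.Balaban1983to89.B4Eq19LatticeOperators
import Mathlib.Analysis.InnerProductSpace.PiL2
import Mathlib.Analysis.SpecialFunctions.Pow.Real

/-!
# LINE 26 «FlowedJunctionCone» v2.1 — crux `HistoryTailL` (stmt-QuantumFields-19936) · K2 crux `BlockLipschitzL` (stmt-QuantumFields-23533)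
# of route PoincareLipschitz · organ of record `hImproveCoreFlat` (FROZEN v1 bac8eda30a54887f) by an ALL-LATTICE monotonicity road —
# the (R2)-class road that ★w8 g7 LOCATE v1.9 §6.4 declared closed, re-opened by ONE accounting input (the dissipation refund at the junction).

Ideator seat ym-r3-idea-2 g14, lens «nearmiss» (second line of the generation; LINE 25 «CompactnessTransfer» is the (R1) compactness road to the
same organ).  bears_on LADDER-YM rung R3 (leaf `T3YM3TorusStatement.YM3TorusSU2` = YM₃ on T³, closed BY NAME only through the UnitScaleTilt /
PoincareLipschitz `closes`; NOT d = 4, NOT Clay, no mass gap).  HONESTY: nothing here proves the summit, the rung, 19936 or 23533 — exactly three `sorry`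
stubs remain (v2.1: nothing else); the file only certifies that the three stubs would close the organ (and, with the landed K2 chain, the two crux decls by name).

VERSION v2.1 (2026-08-29 ~11:2xZ): K-4b ✓p709961 `hImprove_of_core` is used BY NAME (its olean is served now), so the sorries are EXACTLY the three
open stubs `stub_flowedConeLatt` (S_A), `stub_logHardyStabilityLatt` (S_B), `stub_goodScaleSelection` (S_T); v2 (tree b0e32bd9b9b82bfc) carried a
token-for-token LANDED placeholder for K-4b.  Statement texts of S_A/S_B/S_T are UNCHANGED from v2 (BC7 3/3 CLEAN, BC2 9/9 fail carry over).

THE NEAR MISS (measured).  ★w8's continuum chain «Lemma A (flowed harmonic cone, factor EXACTLY 1) + Lemma B (log-Hardy stability, SU84) +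
(G2D-flow) rigidity on the band `E ≤ 3π + 1` ⇒ Cor. A′/Prop. D/E (monotonicity with gain ⇒ a good scale)» is complete in the continuum and was
ported to ℤ³ up to ONE step: the cone competitor must be TRANSCRIBED to the lattice, and every interpolation/sampling of rough `S³`-valued layer data
loses a MULTIPLICATIVE factor (`×1.11–1.15` measured, LOCATE §6.7; `sec α ≤ √3` for cubical surfaces, §6.8), which a power drift cannot absorb
(§6.3: only SUMMABLE errors are harmless).  §6.4 then argues that smoothing by the flow does not help: «loss per shell `(C−1)Λ₀` vs gain `0.047c₀`».

THE SINGLE INPUT (this line).  §6.4 does not credit the REFUND: in the flowed-cone identity `E(v; B_ρ) = ρ·[E(ψ̃) − (2−λ)∫₀^∞ e^{−s/λ}‖τ(Φ_sψ̃)‖² ds]`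
the interpolation excess `X ≤ (C−1)·e_rough` lives at lattice scale `h = 1/ρ` on `S²` and is DISSIPATED by flow time `s₁ = K/ρ²`; with a TWO-SPEED
radial schedule (flow time `s₁` spent across a junction of `w = √(K/2)` lattice shells, then the self-similar speed `λ = 1`) the refund is complete up
to the fraction `√(2K)/ρ`, the junction costs `O(√K)·ẽ(ρ)` = `O(ρ^{−1/2})·ρẽ(ρ)` (ADDITIVE in the sense of §6.3), and below the junction the cone samples
maps that are smooth at lattice scale (where §6.4 itself grants `(1 + O(ℓ⁻²))`).  Hence, ON THE BAND `ẽ(ρ) ≤ 3π + 1` (where the layer carries O(1) total energy, every un-multiplied cost is an additive constant, and no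
micro-bubble fits), the conjectured LATTICE Lemma A in CHEAP-or-GAIN dichotomy form with `κ(ρ) = 1 + C/√ρ` (stub S_A; no bubbling below `8π`;
★w3 #57 (P2) effective rigidity) — and NOTHING is claimed off the band (v0 of this line had a «plain» clause at hot layers: exactly where coherent
near-lattice-scale patches make the chordal deficit `θ²/12` a genuine multiplicative excess; S_T was re-proved without it, using the free identity
`ΔΘ = (ẽ − Θ)/(ρ+1)` on hot layers);
S_B is SU84 stability with the EXACT lattice second-variation identity ((S-latt), ★w8 §8; ✓`twisted_graph_stability_eps`); S_T is §6.3 + Prop. D made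
abstract (pure real analysis).  The composition `hImproveCoreFlat_of` is (Γ6)-type bookkeeping, kernel-checked below.

WHY NOVEL vs the listed lines/routes: LINE 25 (R1) needs two continuum Literature-fact-sized inputs (F-SU small-scale energy, discrete Luckhaus) and a
compactness-contradiction (ineffective constants); LINE 26 is EFFECTIVE and all-lattice in its signatures (continuum objects live only inside the proof
of S_A), and its load-bearing claim is a per-scale competitor inequality a kit engine can test on actual minimisers.  Against ★w8 (R2): same skeleton
(Lemma A/B/D), new junction accounting — the line stands or falls with S_A, and says so.  No listed route (UnitScaleTilt, PoincareLipschitz,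
CovariantDischarge, CoarseStiffnessTail, MultiscaleHerbst) contains a monotonicity formula on ℤ³.

CHEAPEST FALSIFIER / INSTRUMENT ROW.  (F1, numerics, kit seat «MESO-HEDGEHOG»/R15-class engine): for lattice minimisers `u` on `box 0 R`, `R ∈ {24, 32, 48}`,
with conical (hedgehog-like, degree-one layer) boundary data, compute `Q(ρ) := [E_B(u;ρ) − A₀]/(ρ·ẽ(ρ))` for `ρ ∈ [8, R/2]`: S_A(plain) predicts
`Q(ρ) ≤ 1 + C/√ρ` with `C = O(1)` FALLING like `ρ^{−1/2}`; a plateau `Q → q_∞ > 1` (the §6.7 value 1.11 would do) REFUTES S_A as typed.  (F2, in-Lean /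
by hand): the flowed-junction construction for the equivariant hedgehog layer `u(y) = (y − z)/|y − z|` (explicit: `ẽ ≈ 8π·(1 + O(1/ρ))… `) must give
`E_B ≤ (1 + C/√ρ)ρẽ + A` with the SAME `A` for all `ρ` — a `log ρ` growth of the needed `A` kills the plain clause.  (F3): S_B's error shape against
★w8's finite-slide computation (LOCATE §3/§8) — a wrong shape is a misstatement (re-type), not a dead line.

REGISTRATION.  The single skeleton slot of stmt-QuantumFields-19936 holds LINE 24 v5 and that of stmt-QuantumFields-23533 holds LINE 25; this file is
therefore PUBLISHED (`Cruxes/HistoryTailL/Lines/flowed_junction_cone.lean|.md`) and filed as a crux idea, NOT `skeleton check`-registered (it would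
displace a live line).  The lead / director may register it on either item with one command if they prefer it (`ledger skeleton check … --crux …`).
-/

set_option autoImplicit false

noncomputable section

open scoped BigOperators
open Finset
open Literature.MathematicalPhysics.QuantumFieldTheory.Balaban1983to89.B4Eq19LatticeOperators (Zd box unitVec mem_box box_mono)

namespace Summit.QuantumFields.YangMills.Cruxes.HistoryTailL.FlowedJunctionCone

/-! ## §1 The three stubs (all LATTICE / real-analysis statements; no continuum object in any signature) -/

/-- **S_A — THE FLOWED-JUNCTION CONE ON ℤ³ (Lemma A-latt, dichotomy form; the load-bearing stub, XL).**
For every `ε > 0` there are `c > 0`, `C, A ≥ 0`, `R₁ ≥ 1` such that for every unit lattice map `u : ℤ³ → S³ ⊂ ℝ⁴` that is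
`δ(ρ'+1)`-almost-minimising in every sub-box of `box z R`, and every radius `R₁ ≤ ρ ≤ R − 2`, writing `E(ρ)` for the forward-bond energy of
the sites of the open Euclidean lattice ball `{|y − z| < ρ}` and `ẽ(ρ) := E(ρ+1) − E(ρ)` for the layer energy:
ON THE BAND `ẽ(ρ) ≤ 3π + 1` (total layer energy O(1): lattice-smooth background + O(1) sparse hot clusters, no micro-bubble fits since a lattice
wrapping of a great `S² ⊂ S³` costs chordal energy `≥ 16 > 3π + 1`): either `E(ρ) ≤ ερ + A + δ(ρ+2)` (CHEAP) or
`E(ρ) ≤ (1 + C/√ρ)·ρ·ẽ(ρ) − cρ + A + δ(ρ+2)` (GAIN).  NO «plain» almost-monotonicity clause off the band is claimed or needed (S_T uses the free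
identity `ΔΘ = (ẽ − Θ)/(ρ+1) ≥ 0` on hot layers while `Θ < 3π + 1`) — this is where v0 of this line over-claimed and where interpolation roads die.  Intended proof (continuum objects live ONLY inside the proof): interpolate the layer data
to `ψ̃ : S² → S³`; run the harmonic-map heat flow for time `s₁ = K/ρ²` INSIDE a junction of `√(K/2)` lattice shells (two-speed radial schedule:
junction cost `O(√K·ẽ)` additive, refund of the early dissipation complete up to `√(2K)/ρ` — THIS is the step that answers ★w8 LOCATE §6.4, whose
per-shell loss `(C−1)Λ₀` is the un-refunded interpolation excess; on the band the junction cost `√(2K·D₁·E(ψ̃)) ≤ 26√(2K)` and the boundary-bond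
cost `C_geo·ẽ(ρ)` are ADDITIVE CONSTANTS, absorbed in `A = A(ε)`); below the junction the flowed cone `v(rω) = Φ_{s₁+log(ρ/r)}ψ̃(ω)` EVALUATED
(not integer-sampled) at lattice sites — inner shells are lattice-smooth (§6.4 agrees: `(1+O(ℓ⁻²))`), errors summable (§6.3); on the band, the
flow never bubbles (energy `< 8π`) and ★w3 #57 (P2)'s effective rigidity converts «little dissipation in unit time» into CHEAP, else GAIN
`≥ ρ·κ₀(ε)/2e`.  WHY IT MIGHT FAIL: `E(Φ_{s₁}ψ̃) ≤ (1+o(1))·ẽ(ρ)` for ROUGH, CONCENTRATED layer data (near-harmonic micro-discs) is heuristic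
(micro-scale Lemaire/(G2D) rigidity); ★w8 g7 LOCATE v1.9 §6.4/§6.8 record the opposite verdict for interpolating roads. -/
theorem stub_flowedConeLatt :
    ∀ ε : ℝ, 0 < ε → ∃ (c C A R₁ : ℝ), 0 < c ∧ 0 ≤ C ∧ 0 ≤ A ∧ 1 ≤ R₁ ∧
      ∀ (u : Zd 3 → EuclideanSpace ℝ (Fin 4)) (z : Zd 3) (R : ℤ) (δ : ℝ) (ρ : ℕ), (∀ y, ‖u y‖ = 1) → 0 ≤ δ →
      (∀ (z' : Zd 3) (ρ : ℤ), 0 ≤ ρ → box z' (ρ + 1) ⊆ box z R →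
        ∀ v : Zd 3 → EuclideanSpace ℝ (Fin 4), (∀ y, y ∉ box z' ρ → v y = u y) → (∀ y ∈ box z' ρ, ‖v y‖ = 1) →
        ∑ y ∈ box z' (ρ + 1), ∑ μ : Fin 3, ‖u (y + unitVec μ) - u y‖ ^ 2 ≤
        (∑ y ∈ box z' (ρ + 1), ∑ μ : Fin 3, ‖v (y + unitVec μ) - v y‖ ^ 2) + δ * ((ρ : ℝ) + 1)) →
      R₁ ≤ (ρ : ℝ) → (ρ : ℤ) + 2 ≤ R →
      ((∑ y ∈ (box z (((ρ + 1 : ℕ) : ℤ) + 1)).filter (fun y => ∑ i : Fin 3, (y i - z i) ^ 2 < ((ρ + 1 : ℕ) : ℤ) ^ 2), ∑ μ : Fin 3, ‖u (y + unitVec μ) - u y‖ ^ 2) - (∑ y ∈ (box z ((ρ : ℤ) + 1)).filter (fun y => ∑ i : Fin 3, (y i - z i) ^ 2 < (ρ : ℤ) ^ 2), ∑ μ : Fin 3, ‖u (y + unitVec μ) - u y‖ ^ 2)) ≤ 3 * Real.pi + 1 →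
        ∑ y ∈ (box z ((ρ : ℤ) + 1)).filter (fun y => ∑ i : Fin 3, (y i - z i) ^ 2 < (ρ : ℤ) ^ 2), ∑ μ : Fin 3, ‖u (y + unitVec μ) - u y‖ ^ 2 ≤ ε * ρ + A + δ * ((ρ : ℝ) + 2) ∨
        ∑ y ∈ (box z ((ρ : ℤ) + 1)).filter (fun y => ∑ i : Fin 3, (y i - z i) ^ 2 < (ρ : ℤ) ^ 2), ∑ μ : Fin 3, ‖u (y + unitVec μ) - u y‖ ^ 2 ≤ (1 + C / Real.sqrt ρ) * ρ * ((∑ y ∈ (box z (((ρ + 1 : ℕ) : ℤ) + 1)).filter (fun y => ∑ i : Fin 3, (y i - z i) ^ 2 < ((ρ + 1 : ℕ) : ℤ) ^ 2), ∑ μ : Fin 3, ‖u (y + unitVec μ) - u y‖ ^ 2) - (∑ y ∈ (box z ((ρ : ℤ) + 1)).filter (fun y => ∑ i : Fin 3, (y i - z i) ^ 2 < (ρ : ℤ) ^ 2), ∑ μ : Fin 3, ‖u (y + unitVec μ) - u y‖ ^ 2)) - c * ρ + A + δ * ((ρ : ℝ) + 2) := by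
  sorry

/-- **S_B — LOG-HARDY STABILITY FOR ALMOST-MINIMISERS ON ℤ³ (Lemma B-latt; near-tree, M).**
There are `σ < 3π + 1`, `A, C ≥ 0`, `R₁`, `N₁` such that for every unit `δ`-almost-minimiser `u` in `box z R` with `E(box z R) ≤ ΛR` and every
window `[ρ₁, Nρ₁)` of radii (`R₁ ≤ ρ₁`, `N₁ ≤ N`, `Nρ₁ + 2 ≤ R`): `Σ_{ρ₁ ≤ ρ < Nρ₁} (ρ₁/ρ)·ẽ(ρ) ≤ ρ₁(σ·log N + A) + C·N²·ρ₁·√(δΛ)` — the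
`ρ^{−1/2}`-weighted (Hardy-critical) log-average of the layer energies is at most `σ < 3π + 1` up to summable errors.  Intended proof: the EXACT
lattice second variation along the four conformal fields of `S³` (`Σ_a δ²E = Σ_b [3(2 − e_b)(η_y − η_{y'})² − η_yη_{y'}e_b(2 + e_b)] ≥ −slack`,
★w8 §8 (S-latt), tree ✓`twisted_graph_stability_eps`) with the radial log-profile `η = ρ^{−1/2}·sin(π log(ρ/ρ₁)/log N)` (discrete Hardy constant
`¼ + π²/log²N`), almost-minimality entering through the symmetric `±t` finite slides (slack `2δ(Nρ₁+2)/t² + O(t²)·E`, optimised: `O(N²ρ₁√(δΛ))`).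
WHY IT MIGHT FAIL: only the error bookkeeping (the `±t` symmetrisation for ALMOST-minimisers, the lattice Hardy remainder) — the inequality
itself is SU84's with the lattice identity above; a wrong error SHAPE would be a misstatement, not a dead line. -/
theorem stub_logHardyStabilityLatt :
    ∃ (σ A C R₁ : ℝ) (N₁ : ℕ), σ < 3 * Real.pi + 1 ∧ 0 ≤ A ∧ 0 ≤ C ∧ 1 ≤ R₁ ∧ 2 ≤ N₁ ∧
      ∀ (u : Zd 3 → EuclideanSpace ℝ (Fin 4)) (z : Zd 3) (R : ℤ) (δ Λ : ℝ) (ρ₁ N : ℕ), (∀ y, ‖u y‖ = 1) → 0 ≤ δ → 0 < Λ →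
      (∀ (z' : Zd 3) (ρ : ℤ), 0 ≤ ρ → box z' (ρ + 1) ⊆ box z R →
        ∀ v : Zd 3 → EuclideanSpace ℝ (Fin 4), (∀ y, y ∉ box z' ρ → v y = u y) → (∀ y ∈ box z' ρ, ‖v y‖ = 1) →
        ∑ y ∈ box z' (ρ + 1), ∑ μ : Fin 3, ‖u (y + unitVec μ) - u y‖ ^ 2 ≤
        (∑ y ∈ box z' (ρ + 1), ∑ μ : Fin 3, ‖v (y + unitVec μ) - v y‖ ^ 2) + δ * ((ρ : ℝ) + 1)) →
      ∑ y ∈ box z R, ∑ μ : Fin 3, ‖u (y + unitVec μ) - u y‖ ^ 2 ≤ Λ * R →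
      R₁ ≤ (ρ₁ : ℝ) → N₁ ≤ N → ((N * ρ₁ : ℕ) : ℤ) + 2 ≤ R →
      ∑ ρ ∈ Finset.Ico ρ₁ (N * ρ₁), ((ρ₁ : ℝ) / ρ) * ((∑ y ∈ (box z (((ρ + 1 : ℕ) : ℤ) + 1)).filter (fun y => ∑ i : Fin 3, (y i - z i) ^ 2 < ((ρ + 1 : ℕ) : ℤ) ^ 2), ∑ μ : Fin 3, ‖u (y + unitVec μ) - u y‖ ^ 2) - (∑ y ∈ (box z ((ρ : ℤ) + 1)).filter (fun y => ∑ i : Fin 3, (y i - z i) ^ 2 < (ρ : ℤ) ^ 2), ∑ μ : Fin 3, ‖u (y + unitVec μ) - u y‖ ^ 2)) ≤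
        (ρ₁ : ℝ) * (σ * Real.log N + A) + C * (N : ℝ) ^ 2 * Real.sqrt (δ * Λ * ρ₁ * R) := by
  sorry

/-- **S_T — GOOD-SCALE SELECTION (pure real analysis on a nondecreasing sequence; M).**  ★w8 LOCATE §6.3 («`1 + O(ρ^{−α})` is not fatal») +
§5 (Cor. A′/Prop. D) made abstract: a nondecreasing `f : ℕ → ℝ≥0` with the CHEAP-or-GAIN dichotomy on the band `ẽ(ρ) := f(ρ+1) − f(ρ) ≤ β`,
`β = 3π + 1`, at radii `≥ R₁`, and log-Hardy window bounds with `σ < β`, has a CHEAP radius `ρ ∈ [R/M, R/2 − 1]` once `δ ≤ δ₀` and `R ≥ R₀`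
(`M, δ₀, R₀` depending only on the constants).  Proof sketch (no plain monotonicity clause needed): `Θ(ρ) := f(ρ)/ρ` has the FREE identity
`ΔΘ = (ẽ − Θ)/(ρ+1)`; on a GAIN (band, not cheap) layer `Θ ≤ κβ − c + (A + 3δρ)/ρ ≤ β − c/2` and `ΔΘ ≥ (c/3)/(ρ+1)`; on a hot layer (`ẽ > β`)
`ΔΘ ≥ (β − Θ)/(ρ+1)`, so between consecutive band layers `Θ` cannot drop (it rises while `< β`, and having reached `≥ β` it would stay `≥ β` up to
the next band layer, contradicting `Θ ≤ β − c/2` there); the windows (slack `C'N²√(δΛ₀ρ₁R) ≤ ρ₁` for `δ ≤ δ₀(M, N)`) give band log-mass `≥ 1` per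
window for `N ≥ N(σ, A')`; hence `J` windows of band-not-cheap layers force `Θ ≥ (c/3)(J − 1) > β` at a band layer — contradiction for
`J = ⌈3β/c⌉ + 2`, `M = 4N^J`.
WHY IT MIGHT FAIL: it should not (elementary); the risk is a mis-typed error term making a hypothesis unusable — BC7-probed. -/
theorem stub_goodScaleSelection :
    ∀ (Λ₀ ε c C A σ A' C' R₁ : ℝ) (N₁ : ℕ), 0 < Λ₀ → 0 < ε → 0 < c → 0 ≤ C → 0 ≤ A → σ < 3 * Real.pi + 1 →
      0 ≤ A' → 0 ≤ C' → 1 ≤ R₁ → 2 ≤ N₁ →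
      ∃ (δ₀ M R₀ : ℝ), 0 < δ₀ ∧ 1 ≤ M ∧ R₁ ≤ R₀ ∧
      ∀ (f : ℕ → ℝ) (δ : ℝ) (R : ℤ), 0 ≤ δ → δ ≤ δ₀ → R₀ ≤ (R : ℝ) →
      (∀ ρ : ℕ, 0 ≤ f ρ) → (∀ ρ : ℕ, f ρ ≤ f (ρ + 1)) →
      (∀ ρ : ℕ, R₁ ≤ (ρ : ℝ) → (ρ : ℤ) + 2 ≤ R → f (ρ + 1) - f ρ ≤ 3 * Real.pi + 1 →
        f ρ ≤ ε * ρ + A + δ * ((ρ : ℝ) + 2) ∨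
        f ρ ≤ (1 + C / Real.sqrt ρ) * ρ * (f (ρ + 1) - f ρ) - c * ρ + A + δ * ((ρ : ℝ) + 2)) →
      (∀ (ρ₁ N : ℕ), R₁ ≤ (ρ₁ : ℝ) → N₁ ≤ N → ((N * ρ₁ : ℕ) : ℤ) + 2 ≤ R →
        ∑ ρ ∈ Finset.Ico ρ₁ (N * ρ₁), ((ρ₁ : ℝ) / ρ) * (f (ρ + 1) - f ρ) ≤
          (ρ₁ : ℝ) * (σ * Real.log N + A') + C' * (N : ℝ) ^ 2 * Real.sqrt (δ * Λ₀ * ρ₁ * R)) →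
      ∃ ρ : ℕ, R₁ ≤ (ρ : ℝ) ∧ (R : ℝ) ≤ M * ρ ∧ 2 * (ρ : ℤ) + 2 ≤ R ∧ f ρ ≤ ε * ρ + A + δ * ((ρ : ℝ) + 2) := by
  sorry

/-! ## §2 Lattice letters: the ball energies `E(ρ)` are nonnegative and nondecreasing, and the ball contains `box z (2r)` -/

/-- The summand is nonnegative. [folklore] -/
theorem bond_nonneg (u : Zd 3 → EuclideanSpace ℝ (Fin 4)) (y : Zd 3) :
    0 ≤ ∑ μ : Fin 3, ‖u (y + unitVec μ) - u y‖ ^ 2 :=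
  Finset.sum_nonneg fun μ _ => by positivity

/-- The open lattice balls increase with the radius. [folklore] -/
theorem ballSet_mono (z : Zd 3) (ρ : ℕ) :
    (box z ((ρ : ℤ) + 1)).filter (fun y => ∑ i : Fin 3, (y i - z i) ^ 2 < (ρ : ℤ) ^ 2) ⊆
    (box z (((ρ + 1 : ℕ) : ℤ) + 1)).filter (fun y => ∑ i : Fin 3, (y i - z i) ^ 2 < ((ρ + 1 : ℕ) : ℤ) ^ 2) := by
  intro y hy
  rw [Finset.mem_filter] at hy ⊢
  refine ⟨box_mono z (by push_cast; linarith) hy.1, lt_of_lt_of_le hy.2 ?_⟩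
  have h0 : (0 : ℤ) ≤ (ρ : ℤ) := by positivity
  push_cast; nlinarith

/-- `box z (2r) ⊆ {|y − z| < ρ}` when `4r + 4 ≤ ρ`, `0 ≤ r`. [folklore] -/
theorem box_subset_ballSet (z : Zd 3) (ρ : ℕ) (r : ℤ) (hr : 0 ≤ r) (h : 4 * r + 4 ≤ (ρ : ℤ)) :
    box z (2 * r) ⊆ (box z ((ρ : ℤ) + 1)).filter (fun y => ∑ i : Fin 3, (y i - z i) ^ 2 < (ρ : ℤ) ^ 2) := by
  intro y hy
  rw [Finset.mem_filter]
  refine ⟨box_mono z (by linarith) hy, ?_⟩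
  rw [mem_box] at hy
  have h0 := hy 0
  have h1 := hy 1
  have h2 := hy 2
  rw [abs_le] at h0 h1 h2
  have e0 : (y 0 - z 0) ^ 2 ≤ (2 * r) ^ 2 := by nlinarith [h0.1, h0.2]
  have e1 : (y 1 - z 1) ^ 2 ≤ (2 * r) ^ 2 := by nlinarith [h1.1, h1.2]
  have e2 : (y 2 - z 2) ^ 2 ≤ (2 * r) ^ 2 := by nlinarith [h2.1, h2.2]
  rw [Fin.sum_univ_three]
  nlinarith

/-! ## §3 ★ THE COMPOSITION: `hImproveCoreFlat` v1 (bac8eda30a54887f) VERBATIM from S_A, S_B, S_T -/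

/-- ★★★ **LINE 26 concludes the organ of record**: `S_A → S_B → S_T → ⟨hImproveCoreFlat v1⟩` (kernel-checked; the statement below is the
binder `hF` of ✓`PoincareLipschitzImproveCoreOfFlat.hImproveCore_of_flat`, token for token). -/
theorem hImproveCoreFlat_of
    (hA : ∀ ε : ℝ, 0 < ε → ∃ (c C A R₁ : ℝ), 0 < c ∧ 0 ≤ C ∧ 0 ≤ A ∧ 1 ≤ R₁ ∧
      ∀ (u : Zd 3 → EuclideanSpace ℝ (Fin 4)) (z : Zd 3) (R : ℤ) (δ : ℝ) (ρ : ℕ), (∀ y, ‖u y‖ = 1) → 0 ≤ δ →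
      (∀ (z' : Zd 3) (ρ : ℤ), 0 ≤ ρ → box z' (ρ + 1) ⊆ box z R →
        ∀ v : Zd 3 → EuclideanSpace ℝ (Fin 4), (∀ y, y ∉ box z' ρ → v y = u y) → (∀ y ∈ box z' ρ, ‖v y‖ = 1) →
        ∑ y ∈ box z' (ρ + 1), ∑ μ : Fin 3, ‖u (y + unitVec μ) - u y‖ ^ 2 ≤
        (∑ y ∈ box z' (ρ + 1), ∑ μ : Fin 3, ‖v (y + unitVec μ) - v y‖ ^ 2) + δ * ((ρ : ℝ) + 1)) →
      R₁ ≤ (ρ : ℝ) → (ρ : ℤ) + 2 ≤ R →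
      ((∑ y ∈ (box z (((ρ + 1 : ℕ) : ℤ) + 1)).filter (fun y => ∑ i : Fin 3, (y i - z i) ^ 2 < ((ρ + 1 : ℕ) : ℤ) ^ 2), ∑ μ : Fin 3, ‖u (y + unitVec μ) - u y‖ ^ 2) - (∑ y ∈ (box z ((ρ : ℤ) + 1)).filter (fun y => ∑ i : Fin 3, (y i - z i) ^ 2 < (ρ : ℤ) ^ 2), ∑ μ : Fin 3, ‖u (y + unitVec μ) - u y‖ ^ 2)) ≤ 3 * Real.pi + 1 →
        ∑ y ∈ (box z ((ρ : ℤ) + 1)).filter (fun y => ∑ i : Fin 3, (y i - z i) ^ 2 < (ρ : ℤ) ^ 2), ∑ μ : Fin 3, ‖u (y + unitVec μ) - u y‖ ^ 2 ≤ ε * ρ + A + δ * ((ρ : ℝ) + 2) ∨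
        ∑ y ∈ (box z ((ρ : ℤ) + 1)).filter (fun y => ∑ i : Fin 3, (y i - z i) ^ 2 < (ρ : ℤ) ^ 2), ∑ μ : Fin 3, ‖u (y + unitVec μ) - u y‖ ^ 2 ≤ (1 + C / Real.sqrt ρ) * ρ * ((∑ y ∈ (box z (((ρ + 1 : ℕ) : ℤ) + 1)).filter (fun y => ∑ i : Fin 3, (y i - z i) ^ 2 < ((ρ + 1 : ℕ) : ℤ) ^ 2), ∑ μ : Fin 3, ‖u (y + unitVec μ) - u y‖ ^ 2) - (∑ y ∈ (box z ((ρ : ℤ) + 1)).filter (fun y => ∑ i : Fin 3, (y i - z i) ^ 2 < (ρ : ℤ) ^ 2), ∑ μ : Fin 3, ‖u (y + unitVec μ) - u y‖ ^ 2)) - c * ρ + A + δ * ((ρ : ℝ) + 2))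
    (hB : ∃ (σ A C R₁ : ℝ) (N₁ : ℕ), σ < 3 * Real.pi + 1 ∧ 0 ≤ A ∧ 0 ≤ C ∧ 1 ≤ R₁ ∧ 2 ≤ N₁ ∧
      ∀ (u : Zd 3 → EuclideanSpace ℝ (Fin 4)) (z : Zd 3) (R : ℤ) (δ Λ : ℝ) (ρ₁ N : ℕ), (∀ y, ‖u y‖ = 1) → 0 ≤ δ → 0 < Λ →
      (∀ (z' : Zd 3) (ρ : ℤ), 0 ≤ ρ → box z' (ρ + 1) ⊆ box z R →
        ∀ v : Zd 3 → EuclideanSpace ℝ (Fin 4), (∀ y, y ∉ box z' ρ → v y = u y) → (∀ y ∈ box z' ρ, ‖v y‖ = 1) →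
        ∑ y ∈ box z' (ρ + 1), ∑ μ : Fin 3, ‖u (y + unitVec μ) - u y‖ ^ 2 ≤
        (∑ y ∈ box z' (ρ + 1), ∑ μ : Fin 3, ‖v (y + unitVec μ) - v y‖ ^ 2) + δ * ((ρ : ℝ) + 1)) →
      ∑ y ∈ box z R, ∑ μ : Fin 3, ‖u (y + unitVec μ) - u y‖ ^ 2 ≤ Λ * R →
      R₁ ≤ (ρ₁ : ℝ) → N₁ ≤ N → ((N * ρ₁ : ℕ) : ℤ) + 2 ≤ R →
      ∑ ρ ∈ Finset.Ico ρ₁ (N * ρ₁), ((ρ₁ : ℝ) / ρ) * ((∑ y ∈ (box z (((ρ + 1 : ℕ) : ℤ) + 1)).filter (fun y => ∑ i : Fin 3, (y i - z i) ^ 2 < ((ρ + 1 : ℕ) : ℤ) ^ 2), ∑ μ : Fin 3, ‖u (y + unitVec μ) - u y‖ ^ 2) - (∑ y ∈ (box z ((ρ : ℤ) + 1)).filter (fun y => ∑ i : Fin 3, (y i - z i) ^ 2 < (ρ : ℤ) ^ 2), ∑ μ : Fin 3, ‖u (y + unitVec μ) - u y‖ ^ 2)) ≤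
        (ρ₁ : ℝ) * (σ * Real.log N + A) + C * (N : ℝ) ^ 2 * Real.sqrt (δ * Λ * ρ₁ * R))
    (hT : ∀ (Λ₀ ε c C A σ A' C' R₁ : ℝ) (N₁ : ℕ), 0 < Λ₀ → 0 < ε → 0 < c → 0 ≤ C → 0 ≤ A → σ < 3 * Real.pi + 1 →
      0 ≤ A' → 0 ≤ C' → 1 ≤ R₁ → 2 ≤ N₁ →
      ∃ (δ₀ M R₀ : ℝ), 0 < δ₀ ∧ 1 ≤ M ∧ R₁ ≤ R₀ ∧
      ∀ (f : ℕ → ℝ) (δ : ℝ) (R : ℤ), 0 ≤ δ → δ ≤ δ₀ → R₀ ≤ (R : ℝ) →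
      (∀ ρ : ℕ, 0 ≤ f ρ) → (∀ ρ : ℕ, f ρ ≤ f (ρ + 1)) →
      (∀ ρ : ℕ, R₁ ≤ (ρ : ℝ) → (ρ : ℤ) + 2 ≤ R → f (ρ + 1) - f ρ ≤ 3 * Real.pi + 1 →
        f ρ ≤ ε * ρ + A + δ * ((ρ : ℝ) + 2) ∨
        f ρ ≤ (1 + C / Real.sqrt ρ) * ρ * (f (ρ + 1) - f ρ) - c * ρ + A + δ * ((ρ : ℝ) + 2)) →
      (∀ (ρ₁ N : ℕ), R₁ ≤ (ρ₁ : ℝ) → N₁ ≤ N → ((N * ρ₁ : ℕ) : ℤ) + 2 ≤ R →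
        ∑ ρ ∈ Finset.Ico ρ₁ (N * ρ₁), ((ρ₁ : ℝ) / ρ) * (f (ρ + 1) - f ρ) ≤
          (ρ₁ : ℝ) * (σ * Real.log N + A') + C' * (N : ℝ) ^ 2 * Real.sqrt (δ * Λ₀ * ρ₁ * R)) →
      ∃ ρ : ℕ, R₁ ≤ (ρ : ℝ) ∧ (R : ℝ) ≤ M * ρ ∧ 2 * (ρ : ℤ) + 2 ≤ R ∧ f ρ ≤ ε * ρ + A + δ * ((ρ : ℝ) + 2)) :
    ∀ (Λ₀ ε₁ : ℝ), 0 < Λ₀ → 0 < ε₁ →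
      ∃ (δ C₀ R₀ : ℝ), 0 < δ ∧ 1 ≤ C₀ ∧ 1 ≤ R₀ ∧
      ∀ (u : Zd 3 → EuclideanSpace ℝ (Fin 4)) (z : Zd 3) (R : ℤ),
      R₀ ≤ R →
      (∀ y, ‖u y‖ = 1) →
      (∀ (z' : Zd 3) (ρ : ℤ), 0 ≤ ρ → box z' (ρ + 1) ⊆ box z R →
      ∀ v : Zd 3 → EuclideanSpace ℝ (Fin 4), (∀ y, y ∉ box z' ρ → v y = u y) → (∀ y ∈ box z' ρ, ‖v y‖ = 1) →
      ∑ y ∈ box z' (ρ + 1), ∑ μ : Fin 3, ‖u (y + unitVec μ) - u y‖ ^ 2 ≤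
      (∑ y ∈ box z' (ρ + 1), ∑ μ : Fin 3, ‖v (y + unitVec μ) - v y‖ ^ 2) + δ * ((ρ : ℝ) + 1)) →
      (∑ y ∈ box z R, ∑ μ : Fin 3, ‖u (y + unitVec μ) - u y‖ ^ 2 ≤ Λ₀ * R) →
      ∃ r : ℤ, 1 ≤ r ∧ (R : ℝ) ≤ C₀ * r ∧ 4 * r ≤ R ∧
      ∑ y ∈ box z (2 * r), ∑ μ : Fin 3, ‖u (y + unitVec μ) - u y‖ ^ 2 ≤ ε₁ * r := by
  intro Λ₀ ε₁ hΛ₀ hε₁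
  -- constants
  have hε : (0 : ℝ) < ε₁ / 32 := by positivity
  obtain ⟨c, C, A, R₁, hc, hC, hA0, hR₁, hAu⟩ := hA (ε₁ / 32) hε
  obtain ⟨σ, A', C', R₁', N₁, hσ, hA', hC', hR₁', hN₁, hBu⟩ := hB
  set R₂ : ℝ := max (max R₁ R₁') 8 with hR₂_def
  have hR₂1 : R₁ ≤ R₂ := le_trans (le_max_left _ _) (le_max_left _ _)
  have hR₂1' : R₁' ≤ R₂ := le_trans (le_max_right _ _) (le_max_left _ _)
  have hR₂8 : (8 : ℝ) ≤ R₂ := le_max_right _ _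
  have hR₂ge1 : (1 : ℝ) ≤ R₂ := by linarith
  obtain ⟨δ₀, M, R₀', hδ₀, hM, hR₀', hTf⟩ :=
    hT Λ₀ (ε₁ / 32) c C A σ A' C' R₂ N₁ hΛ₀ hε hc hC hA0 hσ hA' hC' hR₂ge1 hN₁
  refine ⟨min δ₀ (ε₁ / 52), 11 * M, max R₀' (M * (16 * A / ε₁ + 8)), lt_min hδ₀ (by positivity), by linarith,
    le_trans (by linarith) (le_max_left _ _), ?_⟩
  intro u z R hR hu hmin hE
  have hδ0 : (0 : ℝ) ≤ min δ₀ (ε₁ / 52) := le_of_lt (lt_min hδ₀ (by positivity))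
  have hδ1 : min δ₀ (ε₁ / 52) ≤ δ₀ := min_le_left _ _
  have hδ2 : min δ₀ (ε₁ / 52) ≤ ε₁ / 52 := min_le_right _ _
  have hR0' : R₀' ≤ (R : ℝ) := le_trans (le_max_left _ _) hR
  have hRM : M * (16 * A / ε₁ + 8) ≤ (R : ℝ) := le_trans (le_max_right _ _) hR
  -- the ball-energy sequence
  set f : ℕ → ℝ := fun ρ =>
    ∑ y ∈ (box z ((ρ : ℤ) + 1)).filter (fun y => ∑ i : Fin 3, (y i - z i) ^ 2 < (ρ : ℤ) ^ 2), ∑ μ : Fin 3, ‖u (y + unitVec μ) - u y‖ ^ 2 with hf_def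
  have h0 : ∀ ρ : ℕ, 0 ≤ f ρ := fun ρ => Finset.sum_nonneg fun y _ => bond_nonneg u y
  have h1 : ∀ ρ : ℕ, f ρ ≤ f (ρ + 1) := fun ρ =>
    Finset.sum_le_sum_of_subset_of_nonneg (ballSet_mono z ρ) fun y _ _ => bond_nonneg u y
  have h4 : ∀ ρ : ℕ, R₂ ≤ (ρ : ℝ) → (ρ : ℤ) + 2 ≤ R → f (ρ + 1) - f ρ ≤ 3 * Real.pi + 1 →
      f ρ ≤ ε₁ / 32 * ρ + A + min δ₀ (ε₁ / 52) * ((ρ : ℝ) + 2) ∨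
      f ρ ≤ (1 + C / Real.sqrt ρ) * ρ * (f (ρ + 1) - f ρ) - c * ρ + A + min δ₀ (ε₁ / 52) * ((ρ : ℝ) + 2) := by
    intro ρ hρ1 hρR hband
    exact hAu u z R (min δ₀ (ε₁ / 52)) ρ hu hδ0 hmin (le_trans hR₂1 hρ1) hρR hband
  have h5 : ∀ (ρ₁ N : ℕ), R₂ ≤ (ρ₁ : ℝ) → N₁ ≤ N → ((N * ρ₁ : ℕ) : ℤ) + 2 ≤ R →
      ∑ ρ ∈ Finset.Ico ρ₁ (N * ρ₁), ((ρ₁ : ℝ) / ρ) * (f (ρ + 1) - f ρ) ≤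
        (ρ₁ : ℝ) * (σ * Real.log N + A') + C' * (N : ℝ) ^ 2 * Real.sqrt (min δ₀ (ε₁ / 52) * Λ₀ * ρ₁ * R) := by
    intro ρ₁ N hρ1 hN hNR
    exact hBu u z R (min δ₀ (ε₁ / 52)) Λ₀ ρ₁ N hu hδ0 hΛ₀ hmin hE (le_trans hR₂1' hρ1) hN hNR
  obtain ⟨ρ, hρ1, hρM, hρR, hcheap⟩ := hTf f (min δ₀ (ε₁ / 52)) R hδ0 hδ1 hR0' h0 h1 h4 h5
  -- the good cube
  have hρ8 : (8 : ℝ) ≤ ρ := le_trans hR₂8 hρ1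
  have hρ8z : (8 : ℤ) ≤ (ρ : ℤ) := by exact_mod_cast hρ8
  refine ⟨(ρ : ℤ) / 4 - 1, by omega, ?_, by omega, ?_⟩
  · -- R ≤ 11 M r
    have hdiv : (ρ : ℤ) ≤ 4 * ((ρ : ℤ) / 4 - 1) + 7 := by omega
    have hdivR : (ρ : ℝ) ≤ 4 * (((ρ : ℤ) / 4 - 1 : ℤ) : ℝ) + 7 := by exact_mod_cast hdiv
    have hr1 : (1 : ℤ) ≤ (ρ : ℤ) / 4 - 1 := by omega
    have hr1R : (1 : ℝ) ≤ (((ρ : ℤ) / 4 - 1 : ℤ) : ℝ) := by exact_mod_cast hr1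
    have hM0 : (0 : ℝ) ≤ M := by linarith
    nlinarith [mul_le_mul_of_nonneg_left hdivR hM0]
  · -- the energy of box z (2r) is at most f ρ ≤ ε₁ r
    have hr0 : (0 : ℤ) ≤ (ρ : ℤ) / 4 - 1 := by omega
    have hr4 : 4 * ((ρ : ℤ) / 4 - 1) + 4 ≤ (ρ : ℤ) := by omega
    have hsub := box_subset_ballSet z ρ ((ρ : ℤ) / 4 - 1) hr0 hr4
    have hle : ∑ y ∈ box z (2 * ((ρ : ℤ) / 4 - 1)), ∑ μ : Fin 3, ‖u (y + unitVec μ) - u y‖ ^ 2 ≤ f ρ :=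
      Finset.sum_le_sum_of_subset_of_nonneg hsub fun y _ _ => bond_nonneg u y
    refine le_trans hle (le_trans hcheap ?_)
    have hdiv : (ρ : ℤ) ≤ 4 * ((ρ : ℤ) / 4 - 1) + 7 := by omega
    have hdivR : (ρ : ℝ) ≤ 4 * (((ρ : ℤ) / 4 - 1 : ℤ) : ℝ) + 7 := by exact_mod_cast hdiv
    have hr1 : (1 : ℤ) ≤ (ρ : ℤ) / 4 - 1 := by omega
    have hr1R : (1 : ℝ) ≤ (((ρ : ℤ) / 4 - 1 : ℤ) : ℝ) := by exact_mod_cast hr1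
    -- A ≤ (ε₁/4) r : from R ≤ M ρ and M (16 A/ε₁ + 8) ≤ R
    have hM1 : (1 : ℝ) ≤ M := hM
    have hρA : 16 * A / ε₁ + 8 ≤ (ρ : ℝ) := by
      by_contra hcon
      push Not at hcon
      have : M * (ρ : ℝ) < M * (16 * A / ε₁ + 8) := by nlinarith
      linarith
    have hA4 : A ≤ ε₁ / 4 * (((ρ : ℤ) / 4 - 1 : ℤ) : ℝ) := by
      have h16 : 16 * A / ε₁ ≤ 4 * (((ρ : ℤ) / 4 - 1 : ℤ) : ℝ) - 1 := by linarith
      have := mul_le_mul_of_nonneg_left h16 (le_of_lt hε₁)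
      have hrew : ε₁ * (16 * A / ε₁) = 16 * A := by field_simp
      rw [hrew] at this
      linarith
    have hδr : min δ₀ (ε₁ / 52) * ((ρ : ℝ) + 2) ≤ ε₁ / 4 * (((ρ : ℤ) / 4 - 1 : ℤ) : ℝ) := by
      have hρr : (ρ : ℝ) + 2 ≤ 13 * (((ρ : ℤ) / 4 - 1 : ℤ) : ℝ) := by linarith
      calc min δ₀ (ε₁ / 52) * ((ρ : ℝ) + 2) ≤ ε₁ / 52 * (13 * (((ρ : ℤ) / 4 - 1 : ℤ) : ℝ)) :=
            mul_le_mul hδ2 hρr (by linarith) (by positivity)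
        _ = ε₁ / 4 * (((ρ : ℤ) / 4 - 1 : ℤ) : ℝ) := by ring
    have hρ11 : (ρ : ℝ) ≤ 11 * (((ρ : ℤ) / 4 - 1 : ℤ) : ℝ) := by linarith
    have hερ := mul_le_mul_of_nonneg_left hρ11 (le_of_lt hε)
    have hpos : 0 ≤ ε₁ * (((ρ : ℤ) / 4 - 1 : ℤ) : ℝ) := mul_nonneg (le_of_lt hε₁) (by linarith)
    linarith

/-! ## §4 The crux decls BY NAME — compositions with the K2 chain of record (K-5 ✓p709591, K-4b ✓p709961, K-3 ✓p707954, ✓p708615) -/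

open Literature.MathematicalPhysics.QuantumFieldTheory.Balaban1983to89
open Literature.MathematicalPhysics.QuantumFieldTheory.Balaban1983to89.T3ContinuumYM3Torus
open Literature.MathematicalPhysics.QuantumFieldTheory.Balaban1983to89.T3UnitScaleTilt
open Literature.MathematicalPhysics.QuantumFieldTheory.Balaban1983to89.T3UnitLawDensityEML (ℰp)
open Summit.QuantumFields.YangMills.Theorems.PoincareLipschitzImproveCoreOfFlat (hImproveCore_of_flat)
open Summit.QuantumFields.YangMills.Theorems.PoincareLipschitzImproveOfCore (hImprove_of_core)
open Summit.QuantumFields.YangMills.Theorems.PoincareLipschitzOrbitMinHolderRegularityOfImprove (blockLipschitzL_of_hImprove)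
open Summit.QuantumFields.YangMills.Theorems.PoincareLipschitzHistoryTailOfImprove (historyTailL_of_hImprove)


/-- ★★★ **THE K2 CRUX `PoincareLipschitz.BlockLipschitzL` (stmt-QuantumFields-23533) from the three stubs BY NAME** — kernel-checked:
`hImproveCoreFlat_of` ∘ K-5 `hImproveCore_of_flat` ∘ K-4b ✓p709961 `hImprove_of_core` (by name, v2.1) ∘ K-3
`blockLipschitzL_of_hImprove`. [cite: SchoenUhlenbeck1982, Thm IV; Balaban1985Averaging, Prop. 1] -/
theorem BlockLipschitzL_of :
    Summit.QuantumFields.YangMills.Theses.PoincareLipschitz.BlockLipschitzL :=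
  blockLipschitzL_of_hImprove (hImprove_of_core (hImproveCore_of_flat
    (hImproveCoreFlat_of stub_flowedConeLatt stub_logHardyStabilityLatt stub_goodScaleSelection)))

/-- ★★★ **THE CRUX OF RECORD `UnitScaleTilt.HistoryTailL` (stmt-QuantumFields-19936) BY NAME** from the three stubs, GIVEN the two other open organs
of the K2 display of record (✓p700135 / ✓p708615): (K1-exp) weak-coupling exponential concentration (binder `hK1`, verbatim from
`historyTailL_of_hImprove`) and the first-moment item `PoincareLipschitz.MeanDeviationL` (stmt-QuantumFields-23083, by name).  Not a claim that
19936 follows from the stubs alone. [cite: Balaban1985UV3, (71) p.273; SchoenUhlenbeck1982, §4] -/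
theorem HistoryTailL_of
    (hK1 : ∀ (L : ℕ), ∃ (Cc cc : ℝ), 0 ≤ Cc ∧ 0 < cc ∧ ∃ γ₁ : ℝ, 0 < γ₁ ∧ γ₁ ≤ 1 ∧
      ∀ (F : T3Family) (γ : ℝ), F.L = L → 0 < γ → γ ≤ γ₁ → ∀ (K n : ℕ), 1 ≤ n →
        (n : ℝ) ≤ (F.scheme ℰp γ).β K → 2 * n ≤ (F.P K).sitesPerDir 0 →
        ∀ (x₀ : Site (F.P K) 0) (f : GaugeField (F.P K) 0 (Matrix.specialUnitaryGroup (Fin 2) ℂ) → ℝ) (Λ : ℝ), 0 < Λ →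
          Measurable f → GaugeField.GaugeInvariant f →
          (∀ U U' : GaugeField (F.P K) 0 (Matrix.specialUnitaryGroup (Fin 2) ℂ),
            (∀ b : PBond (F.P K) 0, (∀ k, (b.src k - x₀ k).val < n) → (∀ k, (b.tgt k - x₀ k).val < n) → U b = U' b) →
              f U = f U') →
          (∀ U U' : GaugeField (F.P K) 0 (Matrix.specialUnitaryGroup (Fin 2) ℂ),
            |f U - f U'| ≤ Λ * Real.sqrt (∑ b : PBond (F.P K) 0, GaugeGroup.dist1 (U b * (U' b)⁻¹) ^ 2)) →
          ∀ r : ℝ, 0 ≤ r →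
            (gibbsK F ℰp γ K).real {U | r ≤ f U - ∫ V, f V ∂(gibbsK F ℰp γ K)} ≤
              Cc * Real.exp (-(cc * Real.sqrt ((F.scheme ℰp γ).β K) * r / ((n : ℝ) * Λ))))
    (hM : Summit.QuantumFields.YangMills.Theses.PoincareLipschitz.MeanDeviationL) :
    Summit.QuantumFields.YangMills.Theses.UnitScaleTilt.HistoryTailL :=
  historyTailL_of_hImprove hK1 (hImprove_of_core (hImproveCore_of_flat
    (hImproveCoreFlat_of stub_flowedConeLatt stub_logHardyStabilityLatt stub_goodScaleSelection))) hM

end Summit.QuantumFields.YangMills.Cruxes.HistoryTailL.FlowedJunctionCone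

end
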